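import Summits.QuantumFields.GaugeBoot.OneOverNCauchy
import Summits.QuantumFields.GaugeBoot.OneOverNLimitStep
import Summits.QuantumFields.GaugeBoot.OneOverNEquation
import HarnessLib

/-!
# The `1/N` expansion to all orders, IV: the limit of one order and its characterisation (gauge-boot, ADDENDUM 30 part D)

HONEST FRAMING (cell `pub-gaugeboot`, page 1 of every file): the venture produces certified bounds
on lattice expectations at stated coupling, gauge group, dimension and torus size; NOT a mass gap,
NOT a continuum limit, NOT a string tension; NOT Yang–Mills-summit-bearing (barriers
`FixedCouplingUltralocality`, `PerturbativeInvisibility`).  Strong-coupling `SO(N)` lattice gauge theory with free boundary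
condition (S. Chatterjee, Comm. Math. Phys. **366** (2019); the `1/N` expansion: S. Chatterjee, J. Jafarov, arXiv:1604.04777);
nothing about four-dimensional continuum Yang–Mills or a mass gap.

## Content

★ `order_limit` — one order of the lane's `1/N` expansion, abstractly.  Data: the order-`ℓ` remainder `Q(Λ, N)` («`R_ℓ`», a
function of the volume, of `N` and of the loop sequence), the two previous remainders `P, P₀` («`R_{ℓ−1}, R_{ℓ−2}`») with their
limits `g₁, g₀` along every admissible sequence of cubes, the exact hierarchy equation
`|t|Q − RHS(Q) = |t|P + Σ_{𝕋^∓}±P + Σ_{𝕄^∓}±P₀`, the a priori bound `|Q(Λ,N)(t)| ≤ BΦ_K(t)` at depth `c(N)` inside `Λ`, and a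
candidate limit `g` («`F_ℓ`», in the assembly `lim` along canonical cubes `[−M₀(N), M₀(N)]^d`).  Conclusion: along EVERY sequence of
cubes `[−M_N, M_N]^d` with `M_N − c(N) → ∞`, `Q([−M_N,M_N]^d, N)(t) → g(t)` for every genuine `t`; `g(∅)` is the common value of
`Q` at `∅`; `|g| ≤ BΦ_K`; and `g` solves the linearised symmetrized master loop equation with source `|t|g₁ + Σ_{𝕋^∓}±g₁ + Σ_{𝕄^∓}±g₀`
(Chatterjee–Jafarov's recursion (5.2) / Theorem 6.1).  Independence of the cubes is uniqueness for the sourced equation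
(sibling `OneOverNEquation.sourced_symmetrized_unique`, passed in as a hypothesis at the given `β`).

Everything is `[folklore]` given the siblings.
-/

noncomputable section

open Filter Topology
open Literature.Probability.LatticeModels (Site box)
open Literature.MathematicalPhysics.QuantumFieldTheory (latticeNorm)
open Literature.MathematicalPhysics.QuantumFieldTheory.Chatterjee2019LargeN
open Literature.MathematicalPhysics.QuantumFieldTheory.Chatterjee2019LargeN.CoeffCatalanBoundProof

namespace Summit.QuantumFields.GaugeBoot

namespace StringDuality

variable {d : ℕ}

/-- `Φ_K(t) ≤ (4K)^{|t|}` for `K ≥ 1`. [cite: Chatterjee2019LargeN, Lemma 10.1 (C_n ≤ 4ⁿ)] -/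
theorem weight_le_pow {K : ℝ} (hK : 1 ≤ K) (t : LoopSeq d) : K ^ t.index * catProd t ≤ (4 * K) ^ t.len := by
  calc K ^ t.index * catProd t ≤ K ^ t.len * 4 ^ t.len :=
        mul_le_mul (pow_le_pow_right₀ hK (Nat.sub_le _ _)) (catProd_le_four_pow t) (catProd_nonneg t) (by positivity)
    _ = (4 * K) ^ t.len := by rw [mul_pow, mul_comm]

/-- ★ **One order of the `1/N` expansion: convergence along every admissible sequence of cubes, value at `∅`, a priori bound,
and the recursive equation of the limit.**  See the module docstring.
[cite: ChatterjeeJafarov2016OneOverN, Theorem 5.1 (recursion (5.2)), Theorem 5.6 (uniqueness), Theorem 6.1; Chatterjee2019LargeN, Theorems 3.6, 9.9] -/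
theorem order_limit {K β B : ℝ} (hK4 : 4 ≤ K) (hB : 0 ≤ B)
    (hθ : 2 / K + |β| * (2 * ((2 * (d - 1) : ℕ) : ℝ) * 256 * K ^ 4) ≤ 3 / 4)
    (hU : ∀ (G ψ ψ' : LoopSeq d → ℝ), ψ [] = ψ' [] →
      (∀ s : LoopSeq d, IsLoopSeq s → |ψ s| ≤ B * (4 * K) ^ s.len) →
      (∀ s : LoopSeq d, IsLoopSeq s → |ψ' s| ≤ B * (4 * K) ^ s.len) →
      (∀ s : LoopSeq d, IsLoopSeq s → s ≠ [] →
          (s.len : ℝ) * ψ s -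
            ((∑ o : InvIdx s, ψ (s.negSplitAt o)) - (∑ o : SameIdx s, ψ (s.posSplitAt o))
              + β * (∑ o : DeformIdx s, ψ (s.negDeformAt o)) - β * (∑ o : DeformIdx s, ψ (s.posDeformAt o))) = G s) →
      (∀ s : LoopSeq d, IsLoopSeq s → s ≠ [] →
          (s.len : ℝ) * ψ' s -
            ((∑ o : InvIdx s, ψ' (s.negSplitAt o)) - (∑ o : SameIdx s, ψ' (s.posSplitAt o))
              + β * (∑ o : DeformIdx s, ψ' (s.negDeformAt o)) - β * (∑ o : DeformIdx s, ψ' (s.posDeformAt o))) = G s) →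
      ∀ s : LoopSeq d, IsLoopSeq s → ψ s = ψ' s)
    (c M₀ : ℕ → ℕ) (hc : ∀ a : ℕ, ∀ᶠ N : ℕ in atTop, c N + a ≤ M₀ N)
    (Q P P₀ : Finset (Site d) → ℕ → LoopSeq d → ℝ) (g g₁ g₀ : LoopSeq d → ℝ) (a : ℝ)
    (hnil : ∀ (Λ : Finset (Site d)) (N : ℕ), Q Λ N [] = a)
    (hg : ∀ t : LoopSeq d, (∃ q : ℝ, Tendsto (fun N : ℕ => Q (box d (M₀ N)) N t) atTop (𝓝 q)) →
      Tendsto (fun N : ℕ => Q (box d (M₀ N)) N t) atTop (𝓝 (g t)))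
    (hAP : ∀ (Λ : Finset (Site d)) (N : ℕ), 2 ≤ N → ∀ t : LoopSeq d, IsLoopSeq t →
      (∀ l ∈ t, ∀ e ∈ l, ∀ v : Site d,
        latticeNorm (v - DEdge.src e) ≤ (c N : ℕ) ∨ latticeNorm (v - DEdge.tgt e) ≤ (c N : ℕ) → v ∈ Λ) →
      |Q Λ N t| ≤ B * (K ^ t.index * catProd t))
    (hEQ : ∀ Λ : Finset (Site d), Λ.Nonempty → ∀ N : ℕ, 2 ≤ N → ∀ t : LoopSeq d, IsLoopSeq t → t ≠ [] →
      (∀ l ∈ t, ∀ e ∈ l, ∀ v : Site d,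
        latticeNorm (v - DEdge.src e) ≤ 1 ∨ latticeNorm (v - DEdge.tgt e) ≤ 1 → v ∈ Λ) →
      (t.len : ℝ) * Q Λ N t -
          ((∑ o : InvIdx t, Q Λ N (t.negSplitAt o)) - (∑ o : SameIdx t, Q Λ N (t.posSplitAt o))
            + β * (∑ o : DeformIdx t, Q Λ N (t.negDeformAt o)) - β * (∑ o : DeformIdx t, Q Λ N (t.posDeformAt o))) =
        (t.len : ℝ) * P Λ N t
          + ((∑ o : SameIdx t, P Λ N (t.negTwistAt o)) - ∑ o : InvIdx t, P Λ N (t.posTwistAt o))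
          + ((∑ o : MergeIdx t, P₀ Λ N (t.negMergeAt o)) - ∑ o : MergeIdx t, P₀ Λ N (t.posMergeAt o)))
    (hC1 : ∀ M : ℕ → ℕ, (∀ a : ℕ, ∀ᶠ N : ℕ in atTop, c N + a ≤ M N) → ∀ t : LoopSeq d, IsLoopSeq t →
      Tendsto (fun N : ℕ => P (box d (M N)) N t) atTop (𝓝 (g₁ t)))
    (hC0 : ∀ M : ℕ → ℕ, (∀ a : ℕ, ∀ᶠ N : ℕ in atTop, c N + a ≤ M N) → ∀ t : LoopSeq d, IsLoopSeq t →
      Tendsto (fun N : ℕ => P₀ (box d (M N)) N t) atTop (𝓝 (g₀ t))) :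
    (∀ M : ℕ → ℕ, (∀ a : ℕ, ∀ᶠ N : ℕ in atTop, c N + a ≤ M N) → ∀ t : LoopSeq d, IsLoopSeq t →
        Tendsto (fun N : ℕ => Q (box d (M N)) N t) atTop (𝓝 (g t))) ∧
      g [] = a ∧
      (∀ t : LoopSeq d, IsLoopSeq t → |g t| ≤ B * (K ^ t.index * catProd t)) ∧
      (∀ t : LoopSeq d, IsLoopSeq t → t ≠ [] →
        (t.len : ℝ) * g t -
            ((∑ o : InvIdx t, g (t.negSplitAt o)) - (∑ o : SameIdx t, g (t.posSplitAt o))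
              + β * (∑ o : DeformIdx t, g (t.negDeformAt o)) - β * (∑ o : DeformIdx t, g (t.posDeformAt o))) =
          (t.len : ℝ) * g₁ t
            + ((∑ o : SameIdx t, g₁ (t.negTwistAt o)) - ∑ o : InvIdx t, g₁ (t.posTwistAt o))
            + ((∑ o : MergeIdx t, g₀ (t.negMergeAt o)) - ∑ o : MergeIdx t, g₀ (t.posMergeAt o))) := by
  have hK1 : 1 ≤ K := by linarith
  have hK0 : 0 ≤ K := by linarith
  have hnilS : IsLoopSeq ([] : LoopSeq d) := fun l hl => by simp at hl
  -- the source along a sequence of cubes and its limit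
  set G : LoopSeq d → ℝ := fun t => (t.len : ℝ) * g₁ t
    + ((∑ o : SameIdx t, g₁ (t.negTwistAt o)) - ∑ o : InvIdx t, g₁ (t.posTwistAt o))
    + ((∑ o : MergeIdx t, g₀ (t.negMergeAt o)) - ∑ o : MergeIdx t, g₀ (t.posMergeAt o)) with hGdef
  -- KEY: along any admissible `M`, any «limit candidate» `q` has all four properties
  have key : ∀ M : ℕ → ℕ, (∀ a : ℕ, ∀ᶠ N : ℕ in atTop, c N + a ≤ M N) → ∀ q : LoopSeq d → ℝ,
      (∀ t : LoopSeq d, (∃ x : ℝ, Tendsto (fun N : ℕ => Q (box d (M N)) N t) atTop (𝓝 x)) →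
        Tendsto (fun N : ℕ => Q (box d (M N)) N t) atTop (𝓝 (q t))) →
      (∀ t : LoopSeq d, IsLoopSeq t → Tendsto (fun N : ℕ => Q (box d (M N)) N t) atTop (𝓝 (q t))) ∧
        q [] = a ∧
        (∀ t : LoopSeq d, IsLoopSeq t → |q t| ≤ B * (K ^ t.index * catProd t)) ∧
        (∀ t : LoopSeq d, IsLoopSeq t → t ≠ [] →
          (t.len : ℝ) * q t -
              ((∑ o : InvIdx t, q (t.negSplitAt o)) - (∑ o : SameIdx t, q (t.posSplitAt o))
                + β * (∑ o : DeformIdx t, q (t.negDeformAt o)) - β * (∑ o : DeformIdx t, q (t.posDeformAt o))) = G t) := by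
    intro M hM q hq
    set QM : ℕ → LoopSeq d → ℝ := fun N t => Q (box d (M N)) N t with hQM
    set SRC : ℕ → LoopSeq d → ℝ := fun N t => (t.len : ℝ) * P (box d (M N)) N t
      + ((∑ o : SameIdx t, P (box d (M N)) N (t.negTwistAt o)) - ∑ o : InvIdx t, P (box d (M N)) N (t.posTwistAt o))
      + ((∑ o : MergeIdx t, P₀ (box d (M N)) N (t.negMergeAt o)) - ∑ o : MergeIdx t, P₀ (box d (M N)) N (t.posMergeAt o))
      with hSRC
    -- the hypotheses of the Cauchy step
    have hE : ∀ᶠ N : ℕ in atTop, ∀ t : LoopSeq d, IsLoopSeq t → t ≠ [] →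
        (∀ l ∈ t, ∀ e ∈ l, ∀ v : Site d,
          latticeNorm (v - DEdge.src e) ≤ 1 ∨ latticeNorm (v - DEdge.tgt e) ≤ 1 → v ∈ box d (M N)) →
        (t.len : ℝ) * QM N t -
            ((∑ o : InvIdx t, QM N (t.negSplitAt o)) - (∑ o : SameIdx t, QM N (t.posSplitAt o))
              + β * (∑ o : DeformIdx t, QM N (t.negDeformAt o)) - β * (∑ o : DeformIdx t, QM N (t.posDeformAt o))) =
          SRC N t := by
      filter_upwards [eventually_ge_atTop 2] with N hN t ht hne hV
      exact hEQ (box d (M N)) (Finset.card_pos.mp (card_box_pos (M N))) N hN t ht hne hV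
    have hSRCconv : ∀ t : LoopSeq d, IsLoopSeq t → Tendsto (fun N : ℕ => SRC N t) atTop (𝓝 (G t)) := by
      intro t ht
      exact ((tendsto_const_nhds.mul (hC1 M hM t ht)).add
        ((tendsto_finsetSum _ fun o _ => hC1 M hM _ (ht.negTwistAt o)).sub
          (tendsto_finsetSum _ fun o _ => hC1 M hM _ (ht.posTwistAt o)))).add
        ((tendsto_finsetSum _ fun o _ => hC0 M hM _ (ht.negMergeAt o)).sub
          (tendsto_finsetSum _ fun o _ => hC0 M hM _ (ht.posMergeAt o)))
    have hAPM : ∀ᶠ N : ℕ in atTop, ∀ t : LoopSeq d, IsLoopSeq t →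
        (∀ l ∈ t, ∀ e ∈ l, ∀ v : Site d,
          latticeNorm (v - DEdge.src e) ≤ (c N : ℕ) ∨ latticeNorm (v - DEdge.tgt e) ≤ (c N : ℕ) → v ∈ box d (M N)) →
        |QM N t| ≤ B * (K ^ t.index * catProd t) := by
      filter_upwards [eventually_ge_atTop 2] with N hN t ht hball
      exact hAP (box d (M N)) N hN t ht hball
    have hconv : ∀ s : LoopSeq d, IsLoopSeq s → ∃ x : ℝ, Tendsto (fun N : ℕ => QM N s) atTop (𝓝 x) :=
      cauchy_of_apriori hK4 hB hθ M c hM QM SRC (fun N N' => by simp only [hQM, hnil]) hE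
        (fun t ht => ⟨G t, hSRCconv t ht⟩) hAPM
    have hq' : ∀ t : LoopSeq d, IsLoopSeq t → Tendsto (fun N : ℕ => QM N t) atTop (𝓝 (q t)) :=
      fun t ht => hq t (hconv t ht)
    refine ⟨hq', ?_, ?_, ?_⟩
    · -- value at `∅`
      have h := hq' [] hnilS
      simp only [hQM, hnil] at h
      exact tendsto_nhds_unique h tendsto_const_nhds
    · -- a priori bound
      intro t ht
      refine limit_bound (hq' t ht) ?_
      filter_upwards [hAPM, eventually_ball hM t 0] with N hN hball
      exact hN t ht (by simpa only [add_zero] using hball)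
    · -- the equation
      intro t ht hne
      exact limit_equation M c hM QM SRC q hq' hE ht hne (hSRCconv t ht)
  -- the canonical sequence and the candidate `g`
  obtain ⟨hg1, hg2, hg3, hg4⟩ := key M₀ hc g hg
  refine ⟨fun M hM t ht => ?_, hg2, hg3, hg4⟩
  -- any admissible sequence: its limit function agrees with `g` by uniqueness
  set q : LoopSeq d → ℝ := fun t => limUnder atTop (fun N : ℕ => Q (box d (M N)) N t) with hqdef
  obtain ⟨hq1, hq2, hq3, hq4⟩ := key M hM q (fun t h => tendsto_nhds_limUnder h)
  have hbound : ∀ (f : LoopSeq d → ℝ), (∀ t : LoopSeq d, IsLoopSeq t → |f t| ≤ B * (K ^ t.index * catProd t)) →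
      ∀ t : LoopSeq d, IsLoopSeq t → |f t| ≤ B * (4 * K) ^ t.len :=
    fun f hf t ht => (hf t ht).trans (mul_le_mul_of_nonneg_left (weight_le_pow hK1 t) hB)
  have heq : q t = g t := hU G q g (by rw [hq2, hg2]) (hbound q hq3) (hbound g hg3) hq4 hg4 t ht
  rw [← heq]
  exact hq1 t ht

end StringDuality

end Summit.QuantumFields.GaugeBoot

end
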